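import Mathlib.Analysis.SpecialFunctions.Pow.Real
import HarnessLib

/-!
# Route `UnitScaleTilt`, crux K1 «MinimiserStabilityRegPr» (stmt-QuantumFields-19200), route-R E′ (A′)-on-Σ, P-A2 (β), rows «(n3)-comb» ∕ `hMcomb₂` ⟸ H2-1(E) —
# (O2) GROUNDWORK, file F-9c-1: THE SLOT LETTERS OF THE (G_j) KNIT — THE ONE-SLOT CONVERSION (pure reals)

«(O2) groundwork — not consumed by any displayed row before the freeze lifts» (★★OWNER `ym3-torus-plan` g29∕g30 RULINGS №20 (2), №22 (c) «(II) GO»).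
Cell `ym3-torus`, D-0154 (3c) R3 twin-width seat `ym-routeR-w3` (gen 9); pen F-9c «(G_j) AT THE MEMBER» (★routeR-w1 g10 PENS ROUND 6, 2026-08-29 12:08Z), file 1 of 2
(file 2 = the knit `…CombHGjHoldsT3`).  THEOREMS ONLY (0 `def`, 0 `sorry`); Mathlib-only; `--supports stmt-QuantumFields-19200 --as helper`, count-neutral.  YM₃ on T³ is a
ladder rung (R3), not the Clay problem; nothing here claims (G_j), `hMcomb`, `hMcomb₂`, (β), `hPA2`, the stub, the crux, d = 4 or the mass gap.

THE POINT (the (G_j) twin of ✓`Prop7CombLevelMassSlotLetters.two_slot_to_hMc_slots`).  ★px18 g5's F-9b `Prop7CornerCombCellGradMember.sum_cell_covGrad_tild_le_B_slot` bounds the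
comb tower's level covariant gradient over a period cell by `(4·Ĝ² + 16d·Qn♯² + 8d·S♯²)·((ρ⁻¹)ˡ)²` with `Ĝ = g₀ + θ_g·e′·m₀·ρ^{2k}·ρ³∕(1−ρ²)`,
`Qn♯ = 2e′θ₂·(e′m₀·ρ^{2k+1}∕(1−ρ²) + (cB0 + cA·ρ^{2k})·ρ³∕(1−ρ⁴))`, `S♯ = cB0 + cA·ρ^{2k} + cB1·Qn♯`; with the knit's choices `cB0 = √c₀·Ĝ`, `cA = CcA·(e′·m₀)`
(✓`hcB0sq_of_choice`∕`hcAsq_of_choice`) every letter is LINEAR in `(g₀, ρ^{2k}·m₀)`, so the bound is `(P·g₀² + Q·(ρ^{2k})²·m₀²)·Lˡ`; the level-0 currencies of ✓F-8c-2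
(`m₀² ≤ M`, `g₀² ≤ 8·CURL + 2·DIV + c_X·ℓ⁻²·M`) and the anchor `(ρ^{2k})² = ℓ⁻²` then give ★ `one_slot_to_hGj_slots`: `≤ ((8P)·(CURL + DIV) + (P·c_X + Q)·ℓ⁻²·M)·Lˡ` —
the `Bg₁·(K+DIV) + Bg₂·ℓ⁻²·M` currency of ★px17 M-4c's `hGj` binder, NO bare `M`.  `PQ_letters` packages the two closed coefficient sums with their signs.
HONEST SCOPE.  Pure real bookkeeping; nothing of F-9b∕F-9c's member statements is proved here.

References: T. Bałaban, CMP **109** (1987) 249–301 [Balaban1987RG1] ((0.4) p.253: the inductive gradient bounds in two currencies); CMP **102** (1985) 277–309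
[Balaban1985Variational] ((2) p.278, (110)–(111) p.294: the `ℓ⁻²·Σ|X|²` slot).
-/

set_option autoImplicit false

noncomputable section

namespace Summit.QuantumFields.YangMills.Theorems.Prop7CombLevelNormGapSlotLetters

/-! ## §1 The one-slot conversion -/

/-- `(a·u + b·v)² ≤ 2a²u² + 2b²v²`. [folklore] -/
theorem sq_lin_two_le (a b u v : ℝ) : (a * u + b * v) ^ 2 ≤ 2 * (a ^ 2 * u ^ 2) + 2 * (b ^ 2 * v ^ 2) := by
  nlinarith [sq_nonneg (a * u - b * v)]

/-- ★ **THE ONE-SLOT CONVERSION.**  Reals: a level gradient `S`, the level-0 letters `m₀ g₀`, the member currencies `M CURL` and `DIV ≥ 0`, the exponent reading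
`Ll = Lˡ ≥ 0`, the squared top anchor `(ρ^{2k})² = ell2inv ≥ 0`, the letters `E θ₂ θg ρ cB1 CcA c₀ cX`, `d ≥ 0`, the knit's CHOICES
`cB0 = √c₀·(g₀ + θg·E·m₀·ρ^{2k}·ρ³∕(1−ρ²))`, `cA = CcA·(E·m₀)` (✓1a `hcB0sq_of_choice`∕`hcAsq_of_choice`), and opaque letters `P Q` for the two closed coefficient sums.
HYPOTHESES: FILE G's pure-B bound `S ≤ (4·Ĝ² + 16d·Qn♯² + 8d·(cB0 + cA·ρ^{2k} + cB1·Qn♯)²)·Ll` in its LITERAL letters (✓`Prop7CornerCombCellGradMember.sum_cell_covGrad_tild_le_B_slot`,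
`e′ ↦ E`), the level-0 currencies `m₀² ≤ M`, `g₀² ≤ 8·CURL + 2·DIV + cX·ell2inv·M` (✓F-8c-2).  CONCLUSION — THE `hGj` SHAPE: `S ≤ ((8P)·(CURL + DIV) + (P·cX + Q)·ell2inv·M)·Ll`,
`P = 8 + 32d·qu² + 16d·su²`, `Q = 8CG² + 32d·qv² + 16d·sv²`, `CG = θg·E·ρ³∕(1−ρ²)`, `qu = a₂√c₀`, `qv = a₁ + a₂(√c₀·CG + CcA·E)`, `su = √c₀ + cB1·qu`,
`sv = √c₀·CG + CcA·E + cB1·qv`, `a₁ = 2Eθ₂·E·ρ∕(1−ρ²)`, `a₂ = 2Eθ₂·ρ³∕(1−ρ⁴)` — every letter linear in `(g₀, ρ^{2k}m₀)`, so NO bare `M`: the B-slot currency of `hMc₂`.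
[cite: Balaban1987RG1, (0.4) p.253; Balaban1985Variational, (2) p.278] -/
theorem one_slot_to_hGj_slots {S m₀ g₀ M CURL DIV Ll ell2inv E θ₂ θg ρ cB1 CcA c₀ cX cB0 cA d P Q : ℝ} {k : ℕ}
    (hDIV : 0 ≤ DIV) (hLl : 0 ≤ Ll) (hell : 0 ≤ ell2inv) (hd : 0 ≤ d) (hr : (ρ ^ (2 * k)) ^ 2 = ell2inv)
    (hcB0 : cB0 = Real.sqrt c₀ * (g₀ + θg * E * m₀ * ρ ^ (2 * k) * (ρ ^ 3 / (1 - ρ ^ 2)))) (hcA : cA = CcA * (E * m₀))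
    (hP : P = 8 + 32 * d * (2 * E * θ₂ * (ρ ^ 3 / (1 - ρ ^ 4)) * Real.sqrt c₀) ^ 2
      + 16 * d * (Real.sqrt c₀ + cB1 * (2 * E * θ₂ * (ρ ^ 3 / (1 - ρ ^ 4)) * Real.sqrt c₀)) ^ 2)
    (hQ : Q = 8 * (θg * E * (ρ ^ 3 / (1 - ρ ^ 2))) ^ 2
      + 32 * d * (2 * E * θ₂ * (E * (ρ / (1 - ρ ^ 2))) + 2 * E * θ₂ * (ρ ^ 3 / (1 - ρ ^ 4)) * (Real.sqrt c₀ * (θg * E * (ρ ^ 3 / (1 - ρ ^ 2))) + CcA * E)) ^ 2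
      + 16 * d * (Real.sqrt c₀ * (θg * E * (ρ ^ 3 / (1 - ρ ^ 2))) + CcA * E
          + cB1 * (2 * E * θ₂ * (E * (ρ / (1 - ρ ^ 2))) + 2 * E * θ₂ * (ρ ^ 3 / (1 - ρ ^ 4)) * (Real.sqrt c₀ * (θg * E * (ρ ^ 3 / (1 - ρ ^ 2))) + CcA * E))) ^ 2)
    (hm : m₀ ^ 2 ≤ M) (hg : g₀ ^ 2 ≤ 8 * CURL + 2 * DIV + cX * ell2inv * M)
    (hS : S ≤ (4 * (g₀ + θg * E * m₀ * ρ ^ (2 * k) * (ρ ^ 3 / (1 - ρ ^ 2))) ^ 2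
          + 16 * d * (2 * E * θ₂ * ((E * m₀) * (ρ ^ (2 * k + 1) / (1 - ρ ^ 2)) + (cB0 + cA * ρ ^ (2 * k)) * (ρ ^ 3 / (1 - ρ ^ 4)))) ^ 2
          + 8 * d * (cB0 + cA * ρ ^ (2 * k) + cB1 * (2 * E * θ₂ * ((E * m₀) * (ρ ^ (2 * k + 1) / (1 - ρ ^ 2)) + (cB0 + cA * ρ ^ (2 * k)) * (ρ ^ 3 / (1 - ρ ^ 4))))) ^ 2)
          * Ll) :
    S ≤ ((8 * P) * (CURL + DIV) + (P * cX + Q) * ell2inv * M) * Ll := by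
  -- the two level-0 variables and the linear letters
  set u : ℝ := g₀ with hu
  set v : ℝ := ρ ^ (2 * k) * m₀ with hv
  set CG : ℝ := θg * E * (ρ ^ 3 / (1 - ρ ^ 2)) with hCG
  set a₁ : ℝ := 2 * E * θ₂ * (E * (ρ / (1 - ρ ^ 2))) with ha₁
  set a₂ : ℝ := 2 * E * θ₂ * (ρ ^ 3 / (1 - ρ ^ 4)) with ha₂
  set qu : ℝ := a₂ * Real.sqrt c₀ with hqu
  set qv : ℝ := a₁ + a₂ * (Real.sqrt c₀ * CG + CcA * E) with hqv
  set su : ℝ := Real.sqrt c₀ + cB1 * qu with hsu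
  set sv : ℝ := Real.sqrt c₀ * CG + CcA * E + cB1 * qv with hsv
  have hr1 : ρ ^ (2 * k + 1) = ρ ^ (2 * k) * ρ := pow_succ ρ (2 * k)
  have hĜ : g₀ + θg * E * m₀ * ρ ^ (2 * k) * (ρ ^ 3 / (1 - ρ ^ 2)) = 1 * u + CG * v := by simp only [hu, hv, hCG]; ring
  have hQn : 2 * E * θ₂ * ((E * m₀) * (ρ ^ (2 * k + 1) / (1 - ρ ^ 2)) + (cB0 + cA * ρ ^ (2 * k)) * (ρ ^ 3 / (1 - ρ ^ 4))) = qu * u + qv * v := by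
    rw [hr1, hcB0, hcA]; simp only [hqu, hqv, ha₁, ha₂, hu, hv, hCG]; ring
  have hSs : cB0 + cA * ρ ^ (2 * k) + cB1 * (2 * E * θ₂ * ((E * m₀) * (ρ ^ (2 * k + 1) / (1 - ρ ^ 2)) + (cB0 + cA * ρ ^ (2 * k)) * (ρ ^ 3 / (1 - ρ ^ 4))))
      = su * u + sv * v := by
    rw [hQn, hcB0, hcA]; simp only [hsu, hsv, hu, hv, hCG]; ring
  rw [hSs, hQn, hĜ] at hS
  -- squares of linear forms
  have e1 := sq_lin_two_le 1 CG u v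
  have e2 := sq_lin_two_le qu qv u v
  have e3 := sq_lin_two_le su sv u v
  have hP0 : 0 ≤ 16 * d := by positivity
  have hP1 : 0 ≤ 8 * d := by positivity
  have hPeq : P = 8 + 32 * d * qu ^ 2 + 16 * d * su ^ 2 := by rw [hP]
  have hQeq : Q = 8 * CG ^ 2 + 32 * d * qv ^ 2 + 16 * d * sv ^ 2 := by rw [hQ]
  have hBG : 4 * (1 * u + CG * v) ^ 2 + 16 * d * (qu * u + qv * v) ^ 2 + 8 * d * (su * u + sv * v) ^ 2 ≤ P * u ^ 2 + Q * v ^ 2 := by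
    have h1 := mul_le_mul_of_nonneg_left e1 (by norm_num : (0 : ℝ) ≤ 4)
    have h2 := mul_le_mul_of_nonneg_left e2 hP0
    have h3 := mul_le_mul_of_nonneg_left e3 hP1
    have e : 4 * (2 * (1 ^ 2 * u ^ 2) + 2 * (CG ^ 2 * v ^ 2)) + 16 * d * (2 * (qu ^ 2 * u ^ 2) + 2 * (qv ^ 2 * v ^ 2))
        + 8 * d * (2 * (su ^ 2 * u ^ 2) + 2 * (sv ^ 2 * v ^ 2))
        = (8 + 32 * d * qu ^ 2 + 16 * d * su ^ 2) * u ^ 2 + (8 * CG ^ 2 + 32 * d * qv ^ 2 + 16 * d * sv ^ 2) * v ^ 2 := by ring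
    rw [hPeq, hQeq]; linarith
  -- the level-0 currencies
  have hPn : 0 ≤ P := by rw [hPeq]; positivity
  have hQn0 : 0 ≤ Q := by rw [hQeq]; positivity
  have hu2 : u ^ 2 ≤ 8 * (CURL + DIV) + cX * ell2inv * M := by simp only [hu]; linarith
  have hv2 : v ^ 2 ≤ ell2inv * M := by
    have : v ^ 2 = ell2inv * m₀ ^ 2 := by simp only [hv]; rw [mul_pow, hr]
    rw [this]; exact mul_le_mul_of_nonneg_left hm hell
  have hfin : P * u ^ 2 + Q * v ^ 2 ≤ (8 * P) * (CURL + DIV) + (P * cX + Q) * ell2inv * M := by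
    have h1 := mul_le_mul_of_nonneg_left hu2 hPn
    have h2 := mul_le_mul_of_nonneg_left hv2 hQn0
    have e : P * (8 * (CURL + DIV) + cX * ell2inv * M) + Q * (ell2inv * M) = (8 * P) * (CURL + DIV) + (P * cX + Q) * ell2inv * M := by ring
    linarith
  calc S ≤ _ := hS
    _ ≤ (P * u ^ 2 + Q * v ^ 2) * Ll := mul_le_mul_of_nonneg_right hBG hLl
    _ ≤ _ := mul_le_mul_of_nonneg_right hfin hLl


/-! ## §2 The two closed coefficient sums, packaged -/

/-- **THE TWO COEFFICIENT SUMS `P`, `Q` OF `one_slot_to_hGj_slots`, AS OPAQUE LETTERS WITH THEIR EQUATIONS AND SIGNS** (so the knit chooses `Bg₁ := 8P`, `Bg₂ := P·c_X + Q`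
before the member and never unfolds them). [bookkeeping] -/
theorem PQ_letters (E θ₂ θg ρ cB1 CcA c₀ d : ℝ) (hd : 0 ≤ d) :
    ∃ P Q : ℝ,
      P = 8 + 32 * d * (2 * E * θ₂ * (ρ ^ 3 / (1 - ρ ^ 4)) * Real.sqrt c₀) ^ 2
        + 16 * d * (Real.sqrt c₀ + cB1 * (2 * E * θ₂ * (ρ ^ 3 / (1 - ρ ^ 4)) * Real.sqrt c₀)) ^ 2 ∧
      Q = 8 * (θg * E * (ρ ^ 3 / (1 - ρ ^ 2))) ^ 2
        + 32 * d * (2 * E * θ₂ * (E * (ρ / (1 - ρ ^ 2))) + 2 * E * θ₂ * (ρ ^ 3 / (1 - ρ ^ 4)) * (Real.sqrt c₀ * (θg * E * (ρ ^ 3 / (1 - ρ ^ 2))) + CcA * E)) ^ 2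
        + 16 * d * (Real.sqrt c₀ * (θg * E * (ρ ^ 3 / (1 - ρ ^ 2))) + CcA * E
            + cB1 * (2 * E * θ₂ * (E * (ρ / (1 - ρ ^ 2))) + 2 * E * θ₂ * (ρ ^ 3 / (1 - ρ ^ 4)) * (Real.sqrt c₀ * (θg * E * (ρ ^ 3 / (1 - ρ ^ 2))) + CcA * E))) ^ 2 ∧
      0 ≤ P ∧ 0 ≤ Q :=
  ⟨_, _, rfl, rfl, by positivity, by positivity⟩

end Summit.QuantumFields.YangMills.Theorems.Prop7CombLevelNormGapSlotLetters

end
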